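import Mathlib
import Summits.ValiantsHypothesis.ValiantsHypothesis.Statement
import Summits.ValiantsHypothesis.ValiantsHypothesis.Theorems.SoloInformedBundleGirth
import HarnessLib

/-!
# Soloist (informed) rung: the jet girth bound — covering targets below a common slope jet (quadspan 2.69)

Session s35 of the soloist programme `solo-ValiantsHypothesis-informed`.

Setting of `soloInformed_bilinearGirth`: columns `u_i = (p i, q i)` of polynomials over a field
and a set `E ⊂ ℕ` of exponents with `X^e = c · (p_i q_j - p_j q_i)`, `c ≠ 0`.

THE MECHANISM.  For ANY polynomial `J` one has the identity
`p_i q_j - p_j q_i = p_i (q_j - J p_j) - p_j (q_i - J p_i)`.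
If `J` is chosen so that both products on the right have order `≥ e` — for a target pair at a node
of the `0`-dendrogram this holds for `J` = the common SLOPE JET `q/p mod t^θ` of the branch class
(quadspan 2.69) — then one of them has order exactly `e`, so
`e = ord(p_y) + ord(q_z - J p_z)` with `{y,z} = {i,j}`: the value `e` is covered by
`V + X`, `V ∋` the orders of the entries, `X ∋` the orders of the corrected entries `q_z - J p_z`,
which lie in the space `W' = W + Σ_{Δ ∈ supp J} t^Δ W` when the entries lie in `W`.  With the
asymmetric sumset girth bound (`soloInformed_asymSumsetGirth`, s34) this gives, for `(K,h)`-free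
`E` with `4k ≤ K`:

* `soloInformed_jetGirth` — `|E| ≤ |X| + 86 k |V|^{1+1/k}` whenever every `e ∈ E` has a realising
  pair and a polynomial `J` with the two order inequalities and `q_z - J p_z ∈ W'` (or the same with
  the roles of `p` and `q` exchanged), `X ⊇` the orders of the nonzero elements of `W'`;
* `soloInformed_jetGirth_finrank` — hence `|E| ≤ dim W' + 86 k (dim W)^{1+1/k}` when the entries
  lie in `W ≤ W'`.

CONSEQUENCES (quadspan 2.69).  (1) SHALLOW COVER (`J` constant, `W' = W`): a target whose level does
not exceed the contact of one of its columns with the constant directions lies in `V + V` — the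
residual of the flag bound `soloInformed_sumsetGirth` sits strictly below the "constant skeleton" of
the dendrogram, and each such class `v` forces `M_v + δ_v ⊆ V`.  (2) JET-EXPONENT BUDGET: with `𝚫` the
set of all exponents occurring in the slope jets of target-carrying classes (below their depths),
`W' = W + Σ_{Δ∈𝚫} t^Δ W` has `dim ≤ (1+|𝚫|) s`, so `|E| ≤ (1+|𝚫|) s + 86 k s^{1+1/k}`: a rank-2
counterexample to the window bound needs `≥ s^{1/2-o(1)}` distinct jet exponents in every gauge
(and, by `soloInformed_rayGirth`, `≥ s^{1/2-o(1)}` rays).  The conversion `n → s` itself remains open.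

References: Bondy–Simonovits, JCTB 16 (1974) 97–105 (through `SoloInformedSumsetGirth`); soloist
notes `paper/quadspan.md` 2.66–2.69, `work/s35/s35.md` §3–§4, `paper/sharpest.md` §9.15.
-/

namespace Summit.ValiantsHypothesis.ValiantsHypothesis.Theorems

open Finset Polynomial

/-- The covering step: if `a b' - a' b = c X^e` (`c ≠ 0`) and, for some `J`, both
`a (b' - J a')` and `a' (b - J a)` have order `≥ e`, then `e = ord y + ord w` with `y ∈ {a, a'}` and
`w ∈ {b' - J a', b - J a}`, both nonzero. -/
theorem solo_jet_step {F : Type*} [Field F] (a a' b b' J : F[X]) (c : F) (e : ℕ) (hc : c ≠ 0)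
    (hdet : a * b' - a' * b = C c * X ^ e)
    (h1 : (e : ℕ∞) ≤ a.trailingDegree + (b' - J * a').trailingDegree)
    (h2 : (e : ℕ∞) ≤ a'.trailingDegree + (b - J * a).trailingDegree) :
    ∃ y w : F[X], y ≠ 0 ∧ w ≠ 0 ∧ (y = a ∨ y = a') ∧ (w = b' - J * a' ∨ w = b - J * a) ∧
      y.natTrailingDegree + w.natTrailingDegree = e := by
  set f₁ : F[X] := a * (b' - J * a') with hf₁
  set f₂ : F[X] := a' * (b - J * a) with hf₂
  have hid : f₁ - f₂ = C c * X ^ e := by rw [hf₁, hf₂, ← hdet]; ring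
  have he : (f₁ - f₂).trailingDegree = (e : ℕ∞) := by
    rw [hid]; exact trailingDegree_C_mul_X_pow e hc
  have h1' : (e : ℕ∞) ≤ f₁.trailingDegree := h1.trans le_trailingDegree_mul
  have h2' : (e : ℕ∞) ≤ f₂.trailingDegree := h2.trans le_trailingDegree_mul
  -- one of `f₁`, `f₂` has order exactly `e`
  have key : f₁.trailingDegree = (e : ℕ∞) ∨ f₂.trailingDegree = (e : ℕ∞) := by
    by_contra hne
    push Not at hne
    have g1 : (e : ℕ∞) < f₁.trailingDegree := lt_of_le_of_ne h1' (Ne.symm hne.1)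
    have g2 : (e : ℕ∞) < f₂.trailingDegree := lt_of_le_of_ne h2' (Ne.symm hne.2)
    have g3 : (e : ℕ∞) < (f₁ - f₂).trailingDegree := by
      rw [sub_eq_add_neg]
      refine lt_of_lt_of_le ?_ (solo_le_trailingDegree_add f₁ (-f₂))
      rw [trailingDegree_neg]
      exact lt_min g1 g2
    rw [he] at g3
    exact lt_irrefl _ g3
  -- read off the factorisation
  have fact : ∀ (y w : F[X]), (y * w).trailingDegree = (e : ℕ∞) →
      y ≠ 0 ∧ w ≠ 0 ∧ y.natTrailingDegree + w.natTrailingDegree = e := by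
    intro y w hyw
    have hne : y * w ≠ 0 := by
      intro h0; rw [h0, trailingDegree_zero] at hyw; exact ENat.top_ne_coe _ hyw
    have hy : y ≠ 0 := left_ne_zero_of_mul hne
    have hw : w ≠ 0 := right_ne_zero_of_mul hne
    refine ⟨hy, hw, ?_⟩
    rw [← natTrailingDegree_mul hy hw]
    exact natTrailingDegree_eq_of_trailingDegree_eq_some hyw
  rcases key with hk | hk
  · obtain ⟨hy, hw, hs⟩ := fact a (b' - J * a') hk
    exact ⟨a, b' - J * a', hy, hw, Or.inl rfl, Or.inl rfl, hs⟩
  · obtain ⟨hy, hw, hs⟩ := fact a' (b - J * a) hk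
    exact ⟨a', b - J * a, hy, hw, Or.inr rfl, Or.inr rfl, hs⟩

/-- **Jet girth bound** (quadspan 2.69; kernel form, s35).  Columns `u_i = (p i, q i)`; `V ⊇` the
orders of all nonzero entries; `W'` a subspace and `R ⊇` the orders of its nonzero elements.  Suppose
every `e ∈ E` is `X^e = c · det(u_i,u_j)` for a pair `(i,j)` and a polynomial `J` such that EITHER
`q_i - J p_i, q_j - J p_j ∈ W'` with `ord p_i + ord (q_j - J p_j) ≥ e` and
`ord p_j + ord (q_i - J p_i) ≥ e`, OR the same with `p` and `q` exchanged.  If `E` is `(K,h)`-free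
with `4k ≤ K`, `1 ≤ k`, `1 ≤ h`, then `|E| ≤ |R| + 86 k |V|^{1+1/k}`. -/
theorem soloInformed_jetGirth {F : Type*} [Field F] {L K h k : ℕ}
    (hk : 1 ≤ k) (hK : 4 * k ≤ K) (hh : 1 ≤ h)
    (p q : Fin L → F[X]) (V : Finset ℕ)
    (hVp : ∀ i, p i ≠ 0 → (p i).natTrailingDegree ∈ V)
    (hVq : ∀ i, q i ≠ 0 → (q i).natTrailingDegree ∈ V)
    (W' : Submodule F F[X]) (R : Finset ℕ)
    (hR : ∀ f ∈ W', f ≠ 0 → f.natTrailingDegree ∈ R)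
    (E : Finset ℕ)
    (hE : ∀ e ∈ E, ∃ i j : Fin L, ∃ J : F[X], ∃ c : F, c ≠ 0 ∧
      p i * q j - p j * q i = C c * X ^ e ∧
      ((q i - J * p i ∈ W' ∧ q j - J * p j ∈ W' ∧
        (e : ℕ∞) ≤ (p i).trailingDegree + (q j - J * p j).trailingDegree ∧
        (e : ℕ∞) ≤ (p j).trailingDegree + (q i - J * p i).trailingDegree) ∨
       (p i - J * q i ∈ W' ∧ p j - J * q j ∈ W' ∧
        (e : ℕ∞) ≤ (q i).trailingDegree + (p j - J * q j).trailingDegree ∧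
        (e : ℕ∞) ≤ (q j).trailingDegree + (p i - J * q i).trailingDegree)))
    (hfree : SoloNatFree K h E) :
    (E.card : ℝ) ≤ R.card + 86 * k * (V.card : ℝ) ^ (1 + 1 / (k : ℝ)) := by
  classical
  -- every `e ∈ E` splits as `ord y + ord w`, `ord y ∈ V`, `w ∈ W'` nonzero
  have key : ∀ e ∈ E, ∃ vv xx : ℕ, vv ∈ V ∧ xx ∈ R ∧ vv + xx = e := by
    intro e he
    obtain ⟨i, j, J, c, hc, hdet, hcase⟩ := hE e he
    rcases hcase with ⟨hWi, hWj, h1, h2⟩ | ⟨hWi, hWj, h1, h2⟩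
    · obtain ⟨y, w, hy, hw, hyc, hwc, hs⟩ := solo_jet_step (p i) (p j) (q i) (q j) J c e hc hdet h1 h2
      refine ⟨y.natTrailingDegree, w.natTrailingDegree, ?_, ?_, hs⟩
      · rcases hyc with rfl | rfl
        · exact hVp i hy
        · exact hVp j hy
      · rcases hwc with rfl | rfl
        · exact hR _ hWj hw
        · exact hR _ hWi hw
    · have hdet' : q i * p j - q j * p i = C (-c) * X ^ e := by
        rw [C_neg, neg_mul, ← hdet]; ring
      obtain ⟨y, w, hy, hw, hyc, hwc, hs⟩ :=
        solo_jet_step (q i) (q j) (p i) (p j) J (-c) e (neg_ne_zero.mpr hc) hdet' h1 h2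
      refine ⟨y.natTrailingDegree, w.natTrailingDegree, ?_, ?_, hs⟩
      · rcases hyc with rfl | rfl
        · exact hVq i hy
        · exact hVq j hy
      · rcases hwc with rfl | rfl
        · exact hR _ hWj hw
        · exact hR _ hWi hw
  choose! v x hv hx hvx using key
  have hxv : ∀ e ∈ E, x e + v e = e := fun e he => by rw [add_comm]; exact hvx e he
  have h1 := soloInformed_asymSumsetGirth hk hK hh E V x v hv hxv hfree
  have himg : (E.image x).card ≤ R.card := by
    apply card_le_card
    intro r hr
    rw [mem_image] at hr
    obtain ⟨e, he, rfl⟩ := hr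
    exact hx e he
  have : ((E.image x).card : ℝ) ≤ R.card := by exact_mod_cast himg
  linarith

/-- **Jet girth bound in terms of dimensions** (quadspan 2.69).  If the entries lie in `W` and the
corrected entries in `W' ≥ W` (for the slope-jet mechanism, `W' = W + Σ_{Δ} t^Δ W` over the jet
exponents `Δ`, of dimension `≤ (1 + #Δ) dim W`), then `|E| ≤ dim W' + 86 k (dim W)^{1+1/k}`. -/
theorem soloInformed_jetGirth_finrank {F : Type*} [Field F] {L K h k : ℕ}
    (hk : 1 ≤ k) (hK : 4 * k ≤ K) (hh : 1 ≤ h)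
    (W W' : Submodule F F[X]) [FiniteDimensional F W] [FiniteDimensional F W']
    (p q : Fin L → F[X]) (hpW : ∀ i, p i ∈ W) (hqW : ∀ i, q i ∈ W)
    (E : Finset ℕ)
    (hE : ∀ e ∈ E, ∃ i j : Fin L, ∃ J : F[X], ∃ c : F, c ≠ 0 ∧
      p i * q j - p j * q i = C c * X ^ e ∧
      ((q i - J * p i ∈ W' ∧ q j - J * p j ∈ W' ∧
        (e : ℕ∞) ≤ (p i).trailingDegree + (q j - J * p j).trailingDegree ∧
        (e : ℕ∞) ≤ (p j).trailingDegree + (q i - J * p i).trailingDegree) ∨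
       (p i - J * q i ∈ W' ∧ p j - J * q j ∈ W' ∧
        (e : ℕ∞) ≤ (q i).trailingDegree + (p j - J * q j).trailingDegree ∧
        (e : ℕ∞) ≤ (q j).trailingDegree + (p i - J * q i).trailingDegree)))
    (hfree : SoloNatFree K h E) :
    (E.card : ℝ) ≤ Module.finrank F W' + 86 * k * (Module.finrank F W : ℝ) ^ (1 + 1 / (k : ℝ)) := by
  classical
  -- `V` = orders of the nonzero entries, `R` = orders of the nonzero elements of `W'`
  set V : Finset ℕ := ((univ : Finset (Fin L)).filter fun i => p i ≠ 0).image
      (fun i => (p i).natTrailingDegree) ∪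
    ((univ : Finset (Fin L)).filter fun i => q i ≠ 0).image (fun i => (q i).natTrailingDegree)
    with hVdef
  have hVp : ∀ i, p i ≠ 0 → (p i).natTrailingDegree ∈ V := fun i hi =>
    mem_union_left _ (mem_image_of_mem _ (mem_filter.mpr ⟨mem_univ i, hi⟩))
  have hVq : ∀ i, q i ≠ 0 → (q i).natTrailingDegree ∈ V := fun i hi =>
    mem_union_right _ (mem_image_of_mem _ (mem_filter.mpr ⟨mem_univ i, hi⟩))
  -- the finite set of orders of nonzero elements of `W'` is bounded via a basis-free count:
  -- `R` := the set of natural numbers `n` such that some nonzero `f ∈ W'` has order `n`,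
  -- which is finite because distinct orders give independent elements.
  have hfin : Set.Finite {n : ℕ | ∃ f ∈ W', f ≠ 0 ∧ f.natTrailingDegree = n} := by
    by_contra hinf
    rw [Set.not_finite] at hinf
    -- pick `finrank W' + 1` distinct orders: contradiction with `solo_card_le_finrank_of_orders`
    obtain ⟨T, hTsub, hTcard⟩ := hinf.exists_subset_card_eq (Module.finrank F W' + 1)
    have hrep : ∀ a ∈ T, ∃ f ∈ W', f ≠ 0 ∧ f.natTrailingDegree = a := fun a ha => hTsub ha
    have := solo_card_le_finrank_of_orders W' T hrep
    omega
  set R : Finset ℕ := hfin.toFinset with hRdef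
  have hR : ∀ f ∈ W', f ≠ 0 → f.natTrailingDegree ∈ R := by
    intro f hf hf0
    rw [hRdef, Set.Finite.mem_toFinset]
    exact ⟨f, hf, hf0, rfl⟩
  have h1 := soloInformed_jetGirth hk hK hh p q V hVp hVq W' R hR E hE hfree
  have hrepR : ∀ a ∈ R, ∃ f ∈ W', f ≠ 0 ∧ f.natTrailingDegree = a := by
    intro a ha
    rw [hRdef, Set.Finite.mem_toFinset] at ha
    exact ha
  have hXcard : R.card ≤ Module.finrank F W' := solo_card_le_finrank_of_orders W' R hrepR
  have hrepV : ∀ a ∈ V, ∃ f ∈ W, f ≠ 0 ∧ f.natTrailingDegree = a := by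
    intro a ha
    rw [hVdef, mem_union] at ha
    rcases ha with ha | ha
    · rw [mem_image] at ha
      obtain ⟨i, hi, rfl⟩ := ha
      exact ⟨p i, hpW i, (mem_filter.mp hi).2, rfl⟩
    · rw [mem_image] at ha
      obtain ⟨i, hi, rfl⟩ := ha
      exact ⟨q i, hqW i, (mem_filter.mp hi).2, rfl⟩
  have hVcard : V.card ≤ Module.finrank F W := solo_card_le_finrank_of_orders W V hrepV
  have hXle : (R.card : ℝ) ≤ Module.finrank F W' := by exact_mod_cast hXcard
  have hpow : (V.card : ℝ) ^ (1 + 1 / (k : ℝ)) ≤ (Module.finrank F W : ℝ) ^ (1 + 1 / (k : ℝ)) :=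
    Real.rpow_le_rpow (by positivity) (by exact_mod_cast hVcard) (by positivity)
  have hk0 : (0 : ℝ) ≤ 86 * k := by positivity
  nlinarith [mul_le_mul_of_nonneg_left hpow hk0]

/-- The dimension of `W + Σ_{Δ ∈ S} X^Δ • W` is at most `(|S| + 1) dim W`. -/
theorem solo_finrank_jetSpace_le {F : Type*} [Field F] (W : Submodule F F[X])
    [FiniteDimensional F W] (S : Finset ℕ) :
    Module.finrank F (W ⊔ S.sup fun Δ => W.map (LinearMap.mulLeft F ((X : F[X]) ^ Δ)) : Submodule F F[X])
      ≤ (S.card + 1) * Module.finrank F W := by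
  classical
  induction S using Finset.induction_on with
  | empty =>
    rw [Finset.sup_empty, sup_bot_eq]
    simp
  | insert a s ha ih =>
    rw [Finset.sup_insert, card_insert_of_notMem ha]
    have e1 : W ⊔ (W.map (LinearMap.mulLeft F ((X : F[X]) ^ a)) ⊔
        s.sup fun Δ => W.map (LinearMap.mulLeft F ((X : F[X]) ^ Δ))) =
        W.map (LinearMap.mulLeft F ((X : F[X]) ^ a)) ⊔
          (W ⊔ s.sup fun Δ => W.map (LinearMap.mulLeft F ((X : F[X]) ^ Δ))) := by
      rw [← sup_assoc, sup_comm W, sup_assoc]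
    rw [e1]
    have e2 := Submodule.finrank_sup_add_finrank_inf_eq
      (W.map (LinearMap.mulLeft F ((X : F[X]) ^ a)))
      (W ⊔ s.sup fun Δ => W.map (LinearMap.mulLeft F ((X : F[X]) ^ Δ)))
    have e3 := Submodule.finrank_map_le (LinearMap.mulLeft F ((X : F[X]) ^ a)) W
    nlinarith

end Summit.ValiantsHypothesis.ValiantsHypothesis.Theorems
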